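import Mathlib
import Summits.AtomisticToContinuum.Crystallization.Theses.GappedShellCensus
import Summits.AtomisticToContinuum.Crystallization.Theses.HullMinimality
import Summits.AtomisticToContinuum.Crystallization.Theorems.PhononSlackCertificatesPeriodicGivenLayered
import Summits.AtomisticToContinuum.Crystallization.Theorems.GappedShellCensusCleanLimitsHaveWindowsReduction
import Literature.MathematicalPhysics.StatisticalMechanics.BarlowStacking
import Literature.MathematicalPhysics.StatisticalMechanics.LocalMatchingCompactness
import Literature.Geometry.DiscreteGeometry.KissingPatterns

/-!
# Skeleton — crux `GappedShellCensus.CleanLimitsHaveWindows` (stmt-AtomisticToContinuum-15932), line `laminar-chain`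

Strategist line (planner-cstrat-stmt-AtomisticToContinuum-15932-s1-0, 2026-08-17). An ALTERNATIVE CUT of the
energetic kernel of the live line `Sketch` (lead c2-0: `stub_cleanTornFree`, `stub_cleanChart`, `stub_trussCoercivity`).

The live line asks ONE inequality (T2, truss coercivity of the full transversal defect `localDefect`) to exactify
in-plane metric, registry, flatness and all inhomogeneous strain at once, against `2 E_LJ(#W)` with zero-mean-stress
matching of the reference parameters. This line splits the same kernel along the product structure
`(in-plane translations ℤ²) × (stacking direction ℤ)`:

* `stub_laminarClosing` (the kernel, GS-using, in-plane half): a rooted, everywhere-clean, rooted-uniformly recurrent,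
  CHARTED hull element of a Lennard-Jones ground-state sequence is LAMINAR — every layer is an exact translate of ONE
  planar lattice `A(ℤu + ℤv)` (arbitrary near-equilateral metric), the layers are parallel, and only the per-layer
  offsets `w m` (registry slips) and heights `z m` remain free. Intended proof: IN-PLANE IRONING — average the squared
  bond-length data of `Z` over the chart's in-plane translations on prisms; the class means are realised by a laminar
  competitor of the same cardinality; Jensen (convexity of the cell energy in squared-length coordinates on the clean
  band, NN struts `(V∘√)'' ∈ [10.9, 104]` against far-field concavity `|V''| ≤ 0.6` beyond `1.26 a`) prices the class
  variance; the landed equal-cardinality window bounds (U)/(L) (`LayeredHull.stub_windowBounds`) and recurrence close it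
  (pattern `CleanHull.stub_closing`). The first-order term vanishes IDENTICALLY (own means), so no matching of
  `(a′, Σ Δz)` and no pinning of homogeneous modes is needed inside the infinite-dimensional inequality.
* `stub_laminarPinning` (finite-fibre chain, L): a laminar rooted clean recurrent hull element is EXACTLY LAYERED
  (equilateral metric, slips at hollow sites ⇒ a Hägg word): the energy per in-plane cell of a laminar set is a 1-D chain
  functional in `(G; w m, z m)`; Jensen over the 3-fold orbit `{d, Rd, R²d}` of the slip/metric data pins slips to the
  3-fold fixed points (hollow sites) and the metric to the isotropic one, layer pair by layer pair (nearest-pair corrugation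
  dominates farther pairs: Gershgorin across layers, exactly as `LayeredHull.stub_convexity` / `stub_closing` of 11779).
* `stub_cleanTornFree`, `stub_cleanChart`: verbatim the live line's K0, K1 (shared; the lead's landing closes them here too).

Composition `CleanLimitsHaveWindows_of`: soft half (`CleanHull.cleanHullRecurrent`, LANDED) ⇒ chart (K0, K1) ⇒ laminar
(`stub_laminarClosing`) ⇒ exactly layered (`stub_laminarPinning`) ⇒ box pinning (`CleanHull.boxPinning`, LANDED) ⇒
`LayeredHull.PeriodicGivenLayered_proof` (stmt-11779, PROVED). Sorry-free modulo the four stubs.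

Disproof honoured: H1 (`IsGroundState`) is used in `stub_laminarClosing` (through (U)), in `stub_laminarPinning` and in the
landed box pinning / 11779 — the ruler-stacked clean set of `Negative.not_cleanLimitsHaveWindows_without_isGroundState` is
laminar AND exactly layered, and dies only in 11779; no stub is an instance of a landed Negative lemma.
-/

noncomputable section

namespace Summit.AtomisticToContinuum.Crystallization.Cruxes.CleanLimitsHaveWindows.LaminarChain

open scoped BigOperators
open Filter Metric
open Literature.MathematicalPhysics.StatisticalMechanics
open Literature.Geometry.DiscreteGeometry
open Summit.AtomisticToContinuum.Crystallization.Theorems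

/-! ## Registered stubs -/

/-- **Stub K0 (clean torn-freeness; geometry, ground-state-free, OPEN — verbatim the live line's `stub_cleanTornFree`).**
In an everywhere-clean set every bond has at least four common bonded neighbours (= route crux `TornFree`, stmt-18069,
restricted to the clean class). [folklore] -/
theorem stub_cleanTornFree : ∀ (Y : Set (EuclideanSpace ℝ (Fin 3))) (a : ℝ), 0 < a →
    (∀ y ∈ Y, ({w ∈ Y | w ≠ y ∧ dist y w ≤ a * (1 + 1 / 50)}.ncard = 12 ∧
        ∀ w ∈ Y, w ≠ y → a * (1 - 1 / 50) ≤ dist y w ∧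
          (dist y w ≤ a * (1 + 1 / 50) ∨ a * (63 / 50) ≤ dist y w)) ∧
      ∃ T : Finset (EuclideanSpace ℝ (Fin 3)), (↑T : Set (EuclideanSpace ℝ (Fin 3))) =
          (fun w => a⁻¹ • (w - y)) '' {w ∈ Y | w ≠ y ∧ dist y w ≤ a * (1 + 1 / 50)} ∧
        (ShellCloseTo (1 / 5) T fccKissingPattern ∨ ShellCloseTo (1 / 5) T hcpKissingPattern)) →
    ∀ y ∈ Y, ∀ v ∈ Y, v ≠ y → dist y v ≤ a * (1 + 1 / 50) →
      4 ≤ {w ∈ Y | w ≠ y ∧ w ≠ v ∧ dist y w ≤ a * (1 + 1 / 50) ∧ dist v w ≤ a * (1 + 1 / 50)}.ncard := by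
  sorry

/-- **Stub K1 (clean chart; geometry, ground-state-free, OPEN — verbatim the live line's `stub_cleanChart`).** A non-empty,
everywhere-clean, torn-free set is, combinatorially, the octet truss of a Barlow stacking. [folklore] -/
theorem stub_cleanChart : ∀ (Z : Set (EuclideanSpace ℝ (Fin 3))) (a : ℝ), 0 < a → Z.Nonempty →
    (∀ y ∈ Z, ({w ∈ Z | w ≠ y ∧ dist y w ≤ a * (1 + 1 / 50)}.ncard = 12 ∧
        ∀ w ∈ Z, w ≠ y → a * (1 - 1 / 50) ≤ dist y w ∧
          (dist y w ≤ a * (1 + 1 / 50) ∨ a * (63 / 50) ≤ dist y w)) ∧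
      ∃ T : Finset (EuclideanSpace ℝ (Fin 3)), (↑T : Set (EuclideanSpace ℝ (Fin 3))) =
          (fun w => a⁻¹ • (w - y)) '' {w ∈ Z | w ≠ y ∧ dist y w ≤ a * (1 + 1 / 50)} ∧
        (ShellCloseTo (1 / 5) T fccKissingPattern ∨ ShellCloseTo (1 / 5) T hcpKissingPattern)) →
    (∀ y ∈ Z, ∀ v ∈ Z, v ≠ y → dist y v ≤ a * (1 + 1 / 50) →
      4 ≤ {w ∈ Z | w ≠ y ∧ w ≠ v ∧ dist y w ≤ a * (1 + 1 / 50) ∧ dist v w ≤ a * (1 + 1 / 50)}.ncard) →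
    ∃ (s : ℤ → ℤ) (Φ : EuclideanSpace ℝ (Fin 3) → EuclideanSpace ℝ (Fin 3)), IsHaggSeq s ∧
      Set.BijOn Φ (barlowStacking 1 (Real.sqrt (2 / 3)) s) Z ∧
      ∀ p ∈ barlowStacking 1 (Real.sqrt (2 / 3)) s, ∀ q ∈ barlowStacking 1 (Real.sqrt (2 / 3)) s, p ≠ q →
        (dist p q = 1 ↔ dist (Φ p) (Φ q) ≤ a * (1 + 1 / 50)) := by
  sorry

/-- **Stub L2 (LAMINAR CLOSING — the kernel of this line; energy, ground-state-USING, OPEN).** A rooted, everywhere-clean,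
rooted-uniformly recurrent hull element `Z` of a Lennard-Jones ground-state sequence (scale `a ∈ [47/50, 1]`) that is charted
as the octet truss of a Barlow stacking is LAMINAR: there are a linear isometry `A`, two horizontal generators `u, v` with
`‖u‖, ‖v‖, ‖u − v‖` in the bond band `[a(1 − 1/50), a(1 + 1/50)]`, horizontal per-layer offsets `w m` and strictly increasing
heights `z m` such that `Z = v₀ + A{ i u + j v + w m + (z m) e₃ }` — every layer an exact translate of ONE planar lattice;
metric, registry slips and heights stay FREE. Strictly weaker than the live line's T3 (`localDefect ≡ 0`); intended proof:
in-plane ironing (Jensen over the chart's in-plane translations in squared-bond-length class coordinates on prisms, own class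
means ⇒ the first-order term vanishes identically; equal-cardinality laminar competitor; landed (U)/(L) + recurrence close the
class variance to zero). why it might fail: the cell energy fails to be convex in squared-length coordinates somewhere on the
clean band once the far-field non-affinity remainder is charged (margin measured PD only for homogeneous metrics: λ_min ≥ 1.07
fcc / 2.62 hcp at the stretched corner, ideator-2 numerics), or a recurrent in-plane modulated clean configuration of energy
density `e_∞` exists (a soft transversal phonon inside the clean window — none known; lead's kit j021957: min dE/ΣD = 0.215 > 0).
[folklore] -/
theorem stub_laminarClosing : ∀ x : (N : ℕ) → (Fin N → EuclideanSpace ℝ (Fin 3)),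
    (∀ N, IsGroundState lennardJones (x N)) →
    ∀ (Z : Set (EuclideanSpace ℝ (Fin 3))) (a : ℝ), 47 / 50 ≤ a → a ≤ 1 → (0 : EuclideanSpace ℝ (Fin 3)) ∈ Z →
    (∀ R ε : ℝ, 0 < ε → ∃ᶠ N in Filter.atTop, ∃ t : EuclideanSpace ℝ (Fin 3), (∀ p ∈ Z, ‖p‖ ≤ R →
        ∃ i : Fin N, dist (x N i + t) p ≤ ε) ∧ (∀ i : Fin N, ‖x N i + t‖ ≤ R → ∃ p ∈ Z, dist (x N i + t) p ≤ ε)) →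
    (∀ y ∈ Z, ({w ∈ Z | w ≠ y ∧ dist y w ≤ a * (1 + 1 / 50)}.ncard = 12 ∧ ∀ w ∈ Z, w ≠ y →
        a * (1 - 1 / 50) ≤ dist y w ∧ (dist y w ≤ a * (1 + 1 / 50) ∨ a * (63 / 50) ≤ dist y w)) ∧
        (∃ T : Finset (EuclideanSpace ℝ (Fin 3)),
        (↑T : Set (EuclideanSpace ℝ (Fin 3))) = (fun w => a⁻¹ • (w - y)) ''
            {w ∈ Z | w ≠ y ∧ dist y w ≤ a * (1 + 1 / 50)} ∧
            (ShellCloseTo (1 / 5) T fccKissingPattern ∨ ShellCloseTo (1 / 5) T hcpKissingPattern))) →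
    (∀ R ε : ℝ, 0 < ε → ∃ G : ℝ, ∀ w ∈ Z, ∃ g ∈ Z, dist g w ≤ G ∧ BallMatch ε R 0 ((fun p => p - g) '' Z) Z) →
    (∃ (s : ℤ → ℤ) (Φ : EuclideanSpace ℝ (Fin 3) → EuclideanSpace ℝ (Fin 3)), IsHaggSeq s ∧
      Set.BijOn Φ (barlowStacking 1 (Real.sqrt (2 / 3)) s) Z ∧
      ∀ p ∈ barlowStacking 1 (Real.sqrt (2 / 3)) s, ∀ q ∈ barlowStacking 1 (Real.sqrt (2 / 3)) s, p ≠ q →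
        (dist p q = 1 ↔ dist (Φ p) (Φ q) ≤ a * (1 + 1 / 50))) →
    ∃ (A : EuclideanSpace ℝ (Fin 3) →ₗᵢ[ℝ] EuclideanSpace ℝ (Fin 3)) (u v : EuclideanSpace ℝ (Fin 3))
      (w : ℤ → EuclideanSpace ℝ (Fin 3)) (z : ℤ → ℝ) (v₀ : EuclideanSpace ℝ (Fin 3)),
      u 2 = 0 ∧ v 2 = 0 ∧ (∀ m : ℤ, w m 2 = 0) ∧
      (a * (1 - 1 / 50) ≤ ‖u‖ ∧ ‖u‖ ≤ a * (1 + 1 / 50)) ∧ (a * (1 - 1 / 50) ≤ ‖v‖ ∧ ‖v‖ ≤ a * (1 + 1 / 50)) ∧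
      (a * (1 - 1 / 50) ≤ ‖u - v‖ ∧ ‖u - v‖ ≤ a * (1 + 1 / 50)) ∧ (∀ m : ℤ, z m < z (m + 1)) ∧
      Z = (fun p => p + v₀) '' {p : EuclideanSpace ℝ (Fin 3) | ∃ m i j : ℤ,
        p = A (((i : ℝ) • u) + ((j : ℝ) • v) + w m + (z m • layerNormal 1))} := by
  sorry

/-- **Stub L3 (LAMINAR PINNING — finite-fibre chain; energy, ground-state-USING, OPEN).** A rooted, everywhere-clean,
rooted-uniformly recurrent hull element of a Lennard-Jones ground-state sequence that is LAMINAR (conclusion shape of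
`stub_laminarClosing`) is EXACTLY LAYERED: equilateral in-plane metric of some spacing `a' > 0`, registry slips exactly at
hollow sites (hence a Hägg word `s`), i.e. `Z = v + A(S(a', s, z))` with increasing heights — verbatim the input of the landed
`CleanHull.boxPinning`. Intended proof: for a laminar set the energy per in-plane cell is an explicit 1-D chain functional
`F(G; (w m, z m)_m) = Σ_m [e_∥(G) + Σ_{k ≥ 1} Φ_G(z (m+k) − z m, w (m+k) − w m)]` (layer sums as in `LayeredHull.stub_layerCake`);
the 3-fold rotation `R` of the triangular lattice acts on the data, `F` is `R`-invariant and (certified numerics, nearest-pair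
corrugation dominating farther pairs à la Gershgorin, cf. `LayeredHull.stub_convexity`) strictly convex on the clean box
`{G 2 %-close to equilateral, slips within 0.04 a of a hollow site, heights in the band}`; Jensen over the orbit `{d, Rd, R²d}`
on prisms prices `Σ_m |d_m − fix_m|²` linearly in the volume, and the landed (U)/(L) + recurrence close it (pattern
`LayeredHull.stub_closing` Part B): slips sit at 3-fold fixed points = hollow sites, the metric is isotropic. why it might fail:
joint convexity of the layer-pair energy in `(G, d, h)` fails somewhere on the clean box (then shrink the box first by the
zero-mean-stress identity, as the landed in-plane/vertical pinning did), or clean laminar sets admit a registry other than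
near-hollow (excluded: a bridge/top slip puts a neighbour in the forbidden annulus `(1.02 a, 1.26 a)` or below `0.98 a`).
[folklore] -/
theorem stub_laminarPinning : ∀ x : (N : ℕ) → (Fin N → EuclideanSpace ℝ (Fin 3)),
    (∀ N, IsGroundState lennardJones (x N)) →
    ∀ (Z : Set (EuclideanSpace ℝ (Fin 3))) (a : ℝ), 47 / 50 ≤ a → a ≤ 1 → (0 : EuclideanSpace ℝ (Fin 3)) ∈ Z →
    (∀ R ε : ℝ, 0 < ε → ∃ᶠ N in Filter.atTop, ∃ t : EuclideanSpace ℝ (Fin 3), (∀ p ∈ Z, ‖p‖ ≤ R →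
        ∃ i : Fin N, dist (x N i + t) p ≤ ε) ∧ (∀ i : Fin N, ‖x N i + t‖ ≤ R → ∃ p ∈ Z, dist (x N i + t) p ≤ ε)) →
    (∀ y ∈ Z, ({w ∈ Z | w ≠ y ∧ dist y w ≤ a * (1 + 1 / 50)}.ncard = 12 ∧ ∀ w ∈ Z, w ≠ y →
        a * (1 - 1 / 50) ≤ dist y w ∧ (dist y w ≤ a * (1 + 1 / 50) ∨ a * (63 / 50) ≤ dist y w)) ∧
        (∃ T : Finset (EuclideanSpace ℝ (Fin 3)),
        (↑T : Set (EuclideanSpace ℝ (Fin 3))) = (fun w => a⁻¹ • (w - y)) ''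
            {w ∈ Z | w ≠ y ∧ dist y w ≤ a * (1 + 1 / 50)} ∧
            (ShellCloseTo (1 / 5) T fccKissingPattern ∨ ShellCloseTo (1 / 5) T hcpKissingPattern))) →
    (∀ R ε : ℝ, 0 < ε → ∃ G : ℝ, ∀ w ∈ Z, ∃ g ∈ Z, dist g w ≤ G ∧ BallMatch ε R 0 ((fun p => p - g) '' Z) Z) →
    (∃ (A : EuclideanSpace ℝ (Fin 3) →ₗᵢ[ℝ] EuclideanSpace ℝ (Fin 3)) (u v : EuclideanSpace ℝ (Fin 3))
      (w : ℤ → EuclideanSpace ℝ (Fin 3)) (z : ℤ → ℝ) (v₀ : EuclideanSpace ℝ (Fin 3)),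
      u 2 = 0 ∧ v 2 = 0 ∧ (∀ m : ℤ, w m 2 = 0) ∧
      (a * (1 - 1 / 50) ≤ ‖u‖ ∧ ‖u‖ ≤ a * (1 + 1 / 50)) ∧ (a * (1 - 1 / 50) ≤ ‖v‖ ∧ ‖v‖ ≤ a * (1 + 1 / 50)) ∧
      (a * (1 - 1 / 50) ≤ ‖u - v‖ ∧ ‖u - v‖ ≤ a * (1 + 1 / 50)) ∧ (∀ m : ℤ, z m < z (m + 1)) ∧
      Z = (fun p => p + v₀) '' {p : EuclideanSpace ℝ (Fin 3) | ∃ m i j : ℤ,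
        p = A (((i : ℝ) • u) + ((j : ℝ) • v) + w m + (z m • layerNormal 1))}) →
    ∃ (a' : ℝ) (A : EuclideanSpace ℝ (Fin 3) →ₗᵢ[ℝ] EuclideanSpace ℝ (Fin 3)) (s : ℤ → ℤ) (z : ℤ → ℝ)
      (v : EuclideanSpace ℝ (Fin 3)), 0 < a' ∧ IsHaggSeq s ∧ (∀ m : ℤ, 0 < z (m + 1) - z m) ∧
      Z = (fun p => p + v) '' {p | ∃ m i j : ℤ, p = A (((i : ℝ) • triangularVec₁ a') +
        ((j : ℝ) • triangularVec₂ a') + ((haggLabel s m : ℝ) • barlowOffset a') + (z m • layerNormal 1))} := by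
  sorry

/-! ## Composition: the crux from the stubs -/

/-- **The crux from the stubs.** `GappedShellCensus.CleanLimitsHaveWindows` (stmt-AtomisticToContinuum-15932): soft half
(a rooted, uniformly recurrent, clean hull element — `CleanHull.cleanHullRecurrent`, LANDED), chart (K0, K1), laminar closing
(L2), laminar pinning (L3), box pinning (`CleanHull.boxPinning`, LANDED) and the PROVED `LayeredHull.PeriodicGivenLayered_proof`
(stmt-11779). [folklore] -/
theorem CleanLimitsHaveWindows_of :
    Summit.AtomisticToContinuum.Crystallization.Theses.GappedShellCensus.CleanLimitsHaveWindows := by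
  intro x hx Y a ha ha1 h0 hlim hclean
  have ha0 : 0 < a := by linarith
  -- soft half: a rooted, uniformly recurrent, clean hull element (landed)
  obtain ⟨Z, hZ0, hZH, hZc, hZr⟩ :=
    CleanHull.cleanHullRecurrent x ha0 h0 (CleanHull.inHull_of_isSubseqLimit hlim) hclean
  -- chart: torn-free (K0) and charted as a Barlow octet truss (K1)
  have hchart := stub_cleanChart Z a ha0 ⟨0, hZ0⟩ hZc (stub_cleanTornFree Z a ha0 hZc)
  -- laminar closing (L2): every layer an exact translate of one planar lattice
  have hlam := stub_laminarClosing x hx Z a ha ha1 hZ0 hZH hZc hZr hchart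
  -- laminar pinning (L3): exactly layered
  obtain ⟨a', A, s, z, v, ha', hs, hz, hZeq⟩ := stub_laminarPinning x hx Z a ha ha1 hZ0 hZH hZc hZr hlam
  -- box pinning (landed): a layered hull element with parameters in the box of stmt-11779
  obtain ⟨a'', A', s', z', h1, h2, hs', hz', hH'⟩ :=
    CleanHull.boxPinning x hx a a' ha ha1 ha' A s z v hs hz Z hZeq hZc hZH (hZeq ▸ hZr)
  -- exit through the proved crux `PeriodicGivenLayered`
  exact LayeredHull.PeriodicGivenLayered_proof x hx ⟨a'', h1, h2, fun R ε hε =>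
    (hH' R ε hε).mono fun N hN => by
      obtain ⟨t, ht⟩ := hN
      exact ⟨A', t, s', z', hs', hz', ht⟩⟩

end Summit.AtomisticToContinuum.Crystallization.Cruxes.CleanLimitsHaveWindows.LaminarChain

end
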